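import Summits.Ventures.Crystal3D.Theorems.StickyWulffConstantGenericWallFloorGeneralRungNotCoaxial
import Summits.Ventures.Crystal3D.Theorems.StickyWulffConstantGenericWallFloorSlotFrameIdentity
import Summits.Ventures.Crystal3D.Theorems.StickyWulffConstantGenericWallFloorNonSaturationCoincidence
import Summits.Ventures.Crystal3D.Theorems.StickyWulffConstantGenericWallFloorNonSaturation
import HarnessLib

/-!
# Rigid fillings have no twin-capped exits: the general rung specialises to ALL non-co-axial pairs

HONEST FRAMING. Part of the venture `Summits/Ventures/Crystal3D` (cell `crystal3d-full`), helper for the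
crux `GenericWallFloor` (stmt-Ventures-19480) of `route-Ventures-StickyWulffConstant`, REGISTERED line
`WallLedgerG` (planner cf-p1 gen 16), stub `stub_twoSlabAdhesion : TwoSlabAdhesion` (THE CRUX of the line).
Rung credit only; F-C1 not moved.

**Theorem (`not_twinCapped_of_rigid`).**  For a NON-co-axial pair and a RIGID configuration (`X ⊆ Λ₁ ∪ Λ₂`,
`1`-separated), no ball `e` with a full-`A₁`-shell predecessor `e − A₁ u` is an exact twin cap (the
structure produced by `exit_twinCap_of_patch`): off coincidence the capped ball would be saturated against
`nonsaturation_offCoincidence` (crystal3d-wulff-p2), at a coincidence site it would have only three empty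
slots against `four_le_card_empty_of_saturated_coincidence_top` (crystal3d-wulff-p2); the predecessor lies on
`Λ₁` because otherwise all its shell balls would be `Λ₂`-balls and the slot sets would coincide
(`slots_not_subset_of_not_coaxial`).  So the residual `#TC₁ + #TC₂` of
`general_twoSlabAdhesion_modulo_twinCaps_of_not_coaxial` VANISHES for rigid fillings of every non-co-axial
pair — including the coincidence / CSL pairs that the rigid rung `rigid_twoSlabAdhesion_of_not_coaxial`
(disjoint lattices) excluded — at the weak charge `1/3770`.

**Corollary (`rigid_twoSlabAdhesion_allPairs`).**  The rigid rung for ALL non-co-axial pairs: rigid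
fillings with clean outer slivers satisfy the two-slab adhesion inequality with gain `πρ²/3770` (inputs
`KissingGap δ`, `KissingClassification δ` by name).

WHAT THIS IS NOT: not the stub (general fillings keep the twin-cap residual; the outer slivers are assumed
clean); the charge `1/3770` is the weak general-ledger constant, not the slot-ledger's `(√3 − √2)`; F-C1
not moved.
-/

noncomputable section

namespace Summit.Ventures.Crystal3D.Theorems

open Summit.Ventures.Crystal3D Finset
open Literature.MathematicalPhysics.StatisticalMechanics (fccStacking barlowStacking IsHaggSeq contactDeficiency)
open scoped InnerProductSpace

open scoped Classical in
/-- **Rigid fillings have no twin-capped exits** (grain `Λ₁ = A₁·Λ₀ + t₁` against `Λ₂`; for the other grain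
swap the roles).  See the module docstring. -/
theorem not_twinCapped_of_rigid
    (A₁ : EuclideanSpace ℝ (Fin 3) ≃ₗᵢ[ℝ] EuclideanSpace ℝ (Fin 3)) (t₁ : EuclideanSpace ℝ (Fin 3))
    (A₂ : EuclideanSpace ℝ (Fin 3) ≃ₗᵢ[ℝ] EuclideanSpace ℝ (Fin 3)) (t₂ : EuclideanSpace ℝ (Fin 3))
    (hnc : ¬ ∃ (L : EuclideanSpace ℝ (Fin 3) ≃ₗᵢ[ℝ] EuclideanSpace ℝ (Fin 3))
        (s₁ s₂ : EuclideanSpace ℝ (Fin 3)) (σ σ' : ℤ → ℤ), IsHaggSeq σ ∧ IsHaggSeq σ' ∧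
        (fun p => A₁ p + t₁) '' fccStacking 1 (Real.sqrt (2 / 3)) ⊆
          (fun p => L p + s₁) '' barlowStacking 1 (Real.sqrt (2 / 3)) σ ∧
        (fun p => A₂ p + t₂) '' fccStacking 1 (Real.sqrt (2 / 3)) ⊆
          (fun p => L p + s₂) '' barlowStacking 1 (Real.sqrt (2 / 3)) σ')
    (X : Finset (EuclideanSpace ℝ (Fin 3))) (hX : ∀ p ∈ X, ∀ q ∈ X, p ≠ q → 1 ≤ dist p q)
    (hrigid : ∀ x ∈ X, x ∈ (fun q => A₁ q + t₁) '' fccStacking 1 (Real.sqrt (2 / 3)) ∨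
      x ∈ (fun q => A₂ q + t₂) '' fccStacking 1 (Real.sqrt (2 / 3)))
    {u : EuclideanSpace ℝ (Fin 3)} (hu : u ∈ fccSlots) {e : EuclideanSpace ℝ (Fin 3)}
    (hd : e - A₁ u ∈ X) (hfull : ∀ w ∈ fccSlots, e - A₁ u + A₁ w ∈ X)
    {n : EuclideanSpace ℝ (Fin 3)} (hn : ‖n‖ = 1)
    (hcls : ∀ w ∈ fccSlots, ⟪A₁ w, n⟫_ℝ = 0 ∨ ⟪A₁ w, n⟫_ℝ = Real.sqrt (2 / 3) ∨ ⟪A₁ w, n⟫_ℝ = -Real.sqrt (2 / 3))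
    (hun : ⟪A₁ u, n⟫_ℝ = Real.sqrt (2 / 3))
    (hnear : ∀ w ∈ fccSlots, ⟪A₁ w, n⟫_ℝ ≤ 0 → e + A₁ w ∈ X)
    (hfar : ∀ w ∈ fccSlots, 0 < ⟪A₁ w, n⟫_ℝ → e + A₁ w ∉ X ∧ e - A₁ w + (2 * ⟪A₁ w, n⟫_ℝ) • n ∈ X) : False := by
  set Λ₁ : Set (EuclideanSpace ℝ (Fin 3)) := (fun q => A₁ q + t₁) '' fccStacking 1 (Real.sqrt (2 / 3)) with hΛ₁
  set Λ₂ : Set (EuclideanSpace ℝ (Fin 3)) := (fun q => A₂ q + t₂) '' fccStacking 1 (Real.sqrt (2 / 3)) with hΛ₂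
  have hrpos : 0 < Real.sqrt (2 / 3) := by positivity
  obtain ⟨hA₁₂, -⟩ := slots_not_subset_of_not_coaxial A₁ t₁ A₂ t₂ hnc
  -- the predecessor `d = e − A₁ u` lies on `Λ₁`
  have hdΛ : e - A₁ u ∈ Λ₁ := by
    by_contra hdΛ
    have hd₂ : e - A₁ u ∈ Λ₂ := (hrigid _ hd).resolve_left hdΛ
    apply hA₁₂
    intro w hw
    have hq := hfull w hw
    rcases hrigid _ hq with hq₁ | hq₂
    · exfalso; apply hdΛ
      have := movedFcc_add_site_mem A₁ t₁ hq₁ (mem_fcc_of_mem_fccSlots (neg_mem_fccSlots hw))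
      rwa [map_neg, add_neg_cancel_right] at this
    · have := sub_mem_image_of_mem_affine A₂ t₂ _ _ hq₂ hd₂
      rwa [add_sub_cancel_left] at this
  have heΛ : e ∈ Λ₁ := by
    have := movedFcc_add_site_mem A₁ t₁ hdΛ (mem_fcc_of_mem_fccSlots hu)
    rwa [sub_add_cancel] at this
  -- the empty slots of `e` are exactly the far ones; there are three far slots
  have hfar3 := card_far_slots_eq_three A₁ hn hcls
  have hempty_sub : (fccSlots.filter fun w => e + A₁ w ∉ X) ⊆ fccSlots.filter fun w => 0 < ⟪A₁ w, n⟫_ℝ := by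
    intro w hw
    rw [mem_filter] at hw ⊢
    refine ⟨hw.1, ?_⟩
    by_contra hle
    push Not at hle
    exact hw.2 (hnear w hw.1 hle)
  have hempty_le : (fccSlots.filter fun w => e + A₁ w ∉ X).card ≤ 3 :=
    (card_le_card hempty_sub).trans hfar3.le
  -- the far slots all have the value `√(2/3)`
  have farval : ∀ w ∈ fccSlots, 0 < ⟪A₁ w, n⟫_ℝ → ⟪A₁ w, n⟫_ℝ = Real.sqrt (2 / 3) := by
    intro w hw hpos
    rcases hcls w hw with h | h | h
    · rw [h] at hpos; exact absurd hpos (lt_irrefl 0)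
    · exact h
    · rw [h] at hpos; linarith
  have hempty_ge : 1 ≤ (fccSlots.filter fun w => e + A₁ w ∉ X).card :=
    Finset.card_pos.2 ⟨u, mem_filter.2 ⟨hu, (hfar u hu (by rw [hun]; exact hrpos)).1⟩⟩
  -- `e` has twelve neighbours: nine near/in-plane slots and three cappers
  have hdeg : (X.filter fun q => dist e q = 1).card = 12 := by
    apply le_antisymm (card_filter_dist_eq_one_le_twelve X hX e)
    -- the near balls
    set N := (fccSlots.filter fun w => ⟪A₁ w, n⟫_ℝ ≤ 0).image fun w => e + A₁ w with hN
    set C := (fccSlots.filter fun w => 0 < ⟪A₁ w, n⟫_ℝ).image fun w => e - A₁ w + (2 * ⟪A₁ w, n⟫_ℝ) • n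
      with hC
    have hNcard : N.card = 9 := by
      rw [hN, card_image_of_injOn]
      · have hsplit := Finset.card_filter_add_card_filter_not (s := fccSlots) (fun w => 0 < ⟪A₁ w, n⟫_ℝ)
        rw [card_fccSlots, hfar3] at hsplit
        have e1 : (fccSlots.filter fun w => ¬ 0 < ⟪A₁ w, n⟫_ℝ) = fccSlots.filter fun w => ⟪A₁ w, n⟫_ℝ ≤ 0 := by
          ext w; simp only [mem_filter, not_lt]
        rw [e1] at hsplit; omega
      · intro w _ w' _ h
        exact A₁.injective (add_left_cancel h)
    have hCcard : C.card = 3 := by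
      rw [hC, card_image_of_injOn, hfar3]
      intro w hw w' hw' h
      rw [Finset.mem_coe, mem_filter] at hw hw'
      have h' : ⟪A₁ w, n⟫_ℝ = ⟪A₁ w', n⟫_ℝ := by
        rw [farval w hw.1 hw.2, farval w' hw'.1 hw'.2]
      have : e - A₁ w = e - A₁ w' := by
        have hh : e - A₁ w + (2 * ⟪A₁ w, n⟫_ℝ) • n = e - A₁ w' + (2 * ⟪A₁ w', n⟫_ℝ) • n := h
        rw [h'] at hh; exact add_right_cancel hh
      exact A₁.injective (sub_right_injective this)
    have hNC : Disjoint N C := by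
      rw [Finset.disjoint_left]
      intro q hqN hqC
      rw [hN, mem_image] at hqN
      rw [hC, mem_image] at hqC
      obtain ⟨w, hw, rfl⟩ := hqN
      obtain ⟨w', hw', heq⟩ := hqC
      have h1 : ⟪(e + A₁ w) - e, n⟫_ℝ ≤ 0 := by rw [add_sub_cancel_left]; exact (mem_filter.1 hw).2
      have h2 : ⟪(e - A₁ w' + (2 * ⟪A₁ w', n⟫_ℝ) • n) - e, n⟫_ℝ = ⟪A₁ w', n⟫_ℝ := by
        rw [show e - A₁ w' + (2 * ⟪A₁ w', n⟫_ℝ) • n - e = (2 * ⟪A₁ w', n⟫_ℝ) • n - A₁ w' by abel,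
          inner_sub_left, inner_smul_left, real_inner_self_eq_norm_sq, hn]; simp; ring
      rw [heq] at h2
      linarith [(mem_filter.1 hw').2]
    have hsub : N ∪ C ⊆ X.filter fun q => dist e q = 1 := by
      intro q hq
      rw [mem_filter]
      rcases mem_union.1 hq with hq | hq
      · rw [hN, mem_image] at hq
        obtain ⟨w, hw, rfl⟩ := hq
        have hw' := mem_filter.1 hw
        exact ⟨hnear w hw'.1 hw'.2, by rw [dist_self_add_right, LinearIsometryEquiv.norm_map,
          norm_eq_one_of_mem_fccSlots hw'.1]⟩
      · rw [hC, mem_image] at hq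
        obtain ⟨w, hw, rfl⟩ := hq
        have hw' := mem_filter.1 hw
        refine ⟨(hfar w hw'.1 hw'.2).2, ?_⟩
        have hval : ⟪A₁ w, n⟫_ℝ = Real.sqrt (2 / 3) := farval w hw'.1 hw'.2
        rw [dist_eq_norm, show e - (e - A₁ w + (2 * ⟪A₁ w, n⟫_ℝ) • n) = A₁ w - (2 * ⟪A₁ w, n⟫_ℝ) • n by abel]
        have hsq : ‖A₁ w - (2 * ⟪A₁ w, n⟫_ℝ) • n‖ ^ 2 = 1 := by
          rw [norm_sub_sq_real, inner_smul_right, norm_smul, LinearIsometryEquiv.norm_map,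
            norm_eq_one_of_mem_fccSlots hw'.1, hn, hval, Real.norm_eq_abs, mul_one, sq_abs]
          ring
        nlinarith [norm_nonneg (A₁ w - (2 * ⟪A₁ w, n⟫_ℝ) • n)]
    calc 12 = N.card + C.card := by rw [hNcard, hCcard]
      _ = (N ∪ C).card := (card_union_of_disjoint hNC).symm
      _ ≤ _ := card_le_card hsub
  -- rigid neighbourhoods
  have hfor : ∀ q ∈ X, dist e q = 1 → q ∉ Λ₁ → q ∈ Λ₂ := fun q hq _ hq₁ => (hrigid q hq).resolve_left hq₁
  by_cases he₂ : e ∈ Λ₂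
  · -- coincidence site: at least four empty slots, but only the three far slots are empty
    have hdown : e + A₁ (-u) ∈ X := hnear (-u) (neg_mem_fccSlots hu) (by rw [map_neg, inner_neg_left, hun]; linarith)
    obtain ⟨h4, -, -⟩ := four_le_card_empty_of_saturated_coincidence_top A₁ A₂ t₁ t₂ e u X hnc heΛ he₂ hX
      (fun q hq _ => hrigid q hq) hu (hfar u hu (by rw [hun]; exact hrpos)).1 hdown hdeg
    omega
  · have h11 := nonsaturation_offCoincidence A₁ A₂ t₁ t₂ e X hnc heΛ he₂ hX hfor hempty_ge
    omega

open scoped Classical in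
/-- **The rigid rung for ALL non-co-axial pairs (coincidence / CSL pairs included).**  For a rigid
filling `X ⊆ Λ₁ ∪ Λ₂` of the cell of a non-co-axial pair, with clean outer slivers, the two-slab
adhesion inequality holds with the GAIN `πρ²/3770` over the face term — the residual twin-cap counts of
`general_twoSlabAdhesion_modulo_twinCaps_of_not_coaxial` vanish by `not_twinCapped_of_rigid`.  Inputs
`KissingGap δ`, `KissingClassification δ` BY NAME (discharged in the tree at `δ = 5/2`). -/
theorem rigid_twoSlabAdhesion_allPairs {δ : ℝ} (hg : KissingGap δ) (hc : KissingClassification δ)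
    (A₁ : EuclideanSpace ℝ (Fin 3) ≃ₗᵢ[ℝ] EuclideanSpace ℝ (Fin 3)) (t₁ : EuclideanSpace ℝ (Fin 3))
    (A₂ : EuclideanSpace ℝ (Fin 3) ≃ₗᵢ[ℝ] EuclideanSpace ℝ (Fin 3)) (t₂ : EuclideanSpace ℝ (Fin 3))
    (hnc : ¬ ∃ (L : EuclideanSpace ℝ (Fin 3) ≃ₗᵢ[ℝ] EuclideanSpace ℝ (Fin 3))
        (s₁ s₂ : EuclideanSpace ℝ (Fin 3)) (σ σ' : ℤ → ℤ), IsHaggSeq σ ∧ IsHaggSeq σ' ∧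
        (fun p => A₁ p + t₁) '' fccStacking 1 (Real.sqrt (2 / 3)) ⊆
          (fun p => L p + s₁) '' barlowStacking 1 (Real.sqrt (2 / 3)) σ ∧
        (fun p => A₂ p + t₂) '' fccStacking 1 (Real.sqrt (2 / 3)) ⊆
          (fun p => L p + s₂) '' barlowStacking 1 (Real.sqrt (2 / 3)) σ') :
    ∃ C R₀ : ℝ, 1 ≤ R₀ ∧ ∀ h : ℝ, 0 ≤ h → ∀ ρ : ℝ, R₀ ≤ ρ →
      ∀ X P₁ P₂ : Finset (EuclideanSpace ℝ (Fin 3)),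
      (∀ p ∈ X, ∀ q ∈ X, p ≠ q → 1 ≤ dist p q) → P₁ ⊆ X → P₂ ⊆ X \ P₁ →
      (∀ p ∈ X, -(2 * R₀) ≤ p 2 ∧ p 2 ≤ h + 2 * R₀ ∧ p 0 ^ 2 + p 1 ^ 2 ≤ ρ ^ 2) →
      (∀ p, p ∈ P₁ ↔ (p ∈ (fun q => A₁ q + t₁) '' fccStacking 1 (Real.sqrt (2 / 3)) ∧
        -(2 * R₀) ≤ p 2 ∧ p 2 ≤ -R₀ ∧ p 0 ^ 2 + p 1 ^ 2 ≤ ρ ^ 2)) →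
      (∀ p, p ∈ P₂ ↔ (p ∈ (fun q => A₂ q + t₂) '' fccStacking 1 (Real.sqrt (2 / 3)) ∧
        h + R₀ ≤ p 2 ∧ p 2 ≤ h + 2 * R₀ ∧ p 0 ^ 2 + p 1 ^ 2 ≤ ρ ^ 2)) →
      -- CLEAN outer slivers
      (∀ p ∈ X, p 2 < -(2 * R₀) + 1 → p ∈ (fun q => A₁ q + t₁) '' fccStacking 1 (Real.sqrt (2 / 3))) →
      (∀ p ∈ X, h + 2 * R₀ - 1 < p 2 → p ∈ (fun q => A₂ q + t₂) '' fccStacking 1 (Real.sqrt (2 / 3))) →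
      -- RIGID filling
      (∀ x ∈ X, x ∈ (fun q => A₁ q + t₁) '' fccStacking 1 (Real.sqrt (2 / 3)) ∨
        x ∈ (fun q => A₂ q + t₂) '' fccStacking 1 (Real.sqrt (2 / 3))) →
      ((((P₁ ×ˢ (X \ P₁)).filter fun pq => dist pq.1 pq.2 = 1).card : ℕ) : ℝ) +
        ((((P₂ ×ˢ ((X \ P₁) \ P₂)).filter fun pq => dist pq.1 pq.2 = 1).card : ℕ) : ℝ) ≤
        contactDeficiency ((X \ P₁) \ P₂) +
          (Real.sqrt 2 / 4 * ∑ᶠ w ∈ {w ∈ fccStacking 1 (Real.sqrt (2 / 3)) | ‖w‖ = 1},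
              |⟪w, A₁.symm (EuclideanSpace.single (2 : Fin 3) (1 : ℝ))⟫_ℝ| +
            Real.sqrt 2 / 4 * ∑ᶠ w ∈ {w ∈ fccStacking 1 (Real.sqrt (2 / 3)) | ‖w‖ = 1},
              |⟪w, A₂.symm (EuclideanSpace.single (2 : Fin 3) (1 : ℝ))⟫_ℝ| - 1 / 3770) * Real.pi * ρ ^ 2 +
          C * (1 + h) * ρ := by
  set e₃ : EuclideanSpace ℝ (Fin 3) := EuclideanSpace.single (2 : Fin 3) (1 : ℝ) with he₃
  have he₃n : ‖e₃‖ = 1 := by rw [he₃, PiLp.norm_single, norm_one]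
  -- steep slots
  obtain ⟨u₁, hu₁Λ, hu₁n, hu₁⟩ := exists_steep_slot (A₁.symm e₃) (by rw [LinearIsometryEquiv.norm_map, he₃n])
  obtain ⟨u₂, hu₂Λ, hu₂n, hu₂⟩ := exists_steep_slot (-A₂.symm e₃)
    (by rw [norm_neg, LinearIsometryEquiv.norm_map, he₃n])
  have hu₁s : u₁ ∈ fccSlots := mem_fccSlots_of_unit hu₁Λ hu₁n
  have hu₂s : u₂ ∈ fccSlots := mem_fccSlots_of_unit hu₂Λ hu₂n
  have hsteep₁ : Real.sqrt 2 / 2 ≤ ⟪A₁ u₁, e₃⟫_ℝ := by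
    rwa [← LinearIsometryEquiv.inner_map_map A₁ u₁, LinearIsometryEquiv.apply_symm_apply] at hu₁
  have hsteep₂ : ⟪A₂ u₂, e₃⟫_ℝ ≤ -(Real.sqrt 2 / 2) := by
    rw [inner_neg_right, ← LinearIsometryEquiv.inner_map_map A₂ u₂, LinearIsometryEquiv.apply_symm_apply] at hu₂
    linarith
  -- the symmetric non-co-axiality
  have hnc' : ¬ ∃ (L : EuclideanSpace ℝ (Fin 3) ≃ₗᵢ[ℝ] EuclideanSpace ℝ (Fin 3))
      (s₁ s₂ : EuclideanSpace ℝ (Fin 3)) (σ σ' : ℤ → ℤ), IsHaggSeq σ ∧ IsHaggSeq σ' ∧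
      (fun p => A₂ p + t₂) '' fccStacking 1 (Real.sqrt (2 / 3)) ⊆
        (fun p => L p + s₁) '' barlowStacking 1 (Real.sqrt (2 / 3)) σ ∧
      (fun p => A₁ p + t₁) '' fccStacking 1 (Real.sqrt (2 / 3)) ⊆
        (fun p => L p + s₂) '' barlowStacking 1 (Real.sqrt (2 / 3)) σ' := by
    rintro ⟨L, s₁, s₂, σ, σ', hσ, hσ', h₂, h₁⟩
    exact hnc ⟨L, s₂, s₁, σ', σ, hσ', hσ, h₁, h₂⟩
  obtain ⟨C, R₀, hR₀, H⟩ := general_twoSlabAdhesion_modulo_twinCaps_of_not_coaxial hg hc A₁ t₁ A₂ t₂ hnc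
    hu₁s hsteep₁ hu₂s hsteep₂
  refine ⟨C, R₀, hR₀, ?_⟩
  intro h hh ρ hρ X P₁ P₂ hX hP₁X hP₂X hcell hP₁ hP₂ hclean₁ hclean₂ hrigid
  have key := H h hh ρ hρ X P₁ P₂ hX hP₁X hP₂X hcell hP₁ hP₂ hclean₁ hclean₂
  have hrigid' : ∀ x ∈ X, x ∈ (fun q => A₂ q + t₂) '' fccStacking 1 (Real.sqrt (2 / 3)) ∨
      x ∈ (fun q => A₁ q + t₁) '' fccStacking 1 (Real.sqrt (2 / 3)) := fun x hx => (hrigid x hx).symm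
  have hTC₁ : ((X.filter fun e => e - A₁ u₁ ∈ X ∧ (∀ w ∈ fccSlots, e - A₁ u₁ + A₁ w ∈ X) ∧
        ∃ v ∈ fccSlots, e + A₁ v ∉ X).filter fun e => ∃ n : EuclideanSpace ℝ (Fin 3), ‖n‖ = 1 ∧
      (∀ w ∈ fccSlots, ⟪A₁ w, n⟫_ℝ = 0 ∨ ⟪A₁ w, n⟫_ℝ = Real.sqrt (2 / 3) ∨
        ⟪A₁ w, n⟫_ℝ = -Real.sqrt (2 / 3)) ∧
      ⟪A₁ u₁, n⟫_ℝ = Real.sqrt (2 / 3) ∧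
      (∀ w ∈ fccSlots, ⟪A₁ w, n⟫_ℝ ≤ 0 → e + A₁ w ∈ X) ∧
      (∀ w ∈ fccSlots, 0 < ⟪A₁ w, n⟫_ℝ → e + A₁ w ∉ X ∧ e - A₁ w + (2 * ⟪A₁ w, n⟫_ℝ) • n ∈ X)).card = 0 := by
    refine Finset.card_eq_zero.2 (Finset.filter_eq_empty_iff.2 ?_)
    intro e he
    obtain ⟨-, hd, hfull, -⟩ := mem_filter.1 he
    rintro ⟨n, hn, hcls, hun, hnear, hfar⟩
    exact not_twinCapped_of_rigid A₁ t₁ A₂ t₂ hnc X hX hrigid hu₁s hd hfull hn hcls hun hnear hfar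
  have hTC₂ : ((X.filter fun e => e - A₂ u₂ ∈ X ∧ (∀ w ∈ fccSlots, e - A₂ u₂ + A₂ w ∈ X) ∧
        ∃ v ∈ fccSlots, e + A₂ v ∉ X).filter fun e => ∃ n : EuclideanSpace ℝ (Fin 3), ‖n‖ = 1 ∧
      (∀ w ∈ fccSlots, ⟪A₂ w, n⟫_ℝ = 0 ∨ ⟪A₂ w, n⟫_ℝ = Real.sqrt (2 / 3) ∨
        ⟪A₂ w, n⟫_ℝ = -Real.sqrt (2 / 3)) ∧
      ⟪A₂ u₂, n⟫_ℝ = Real.sqrt (2 / 3) ∧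
      (∀ w ∈ fccSlots, ⟪A₂ w, n⟫_ℝ ≤ 0 → e + A₂ w ∈ X) ∧
      (∀ w ∈ fccSlots, 0 < ⟪A₂ w, n⟫_ℝ → e + A₂ w ∉ X ∧ e - A₂ w + (2 * ⟪A₂ w, n⟫_ℝ) • n ∈ X)).card = 0 := by
    refine Finset.card_eq_zero.2 (Finset.filter_eq_empty_iff.2 ?_)
    intro e he
    obtain ⟨-, hd, hfull, -⟩ := mem_filter.1 he
    rintro ⟨n, hn, hcls, hun, hnear, hfar⟩
    exact not_twinCapped_of_rigid A₂ t₂ A₁ t₁ hnc' X hX hrigid' hu₂s hd hfull hn hcls hun hnear hfar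
  rw [hTC₁, hTC₂] at key
  simp only [Nat.cast_zero, add_zero, zero_div] at key
  exact key

end Summit.Ventures.Crystal3D.Theorems

end
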